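import Summits.BirchSwinnertonDyer.BirchSwinnertonDyer.Theorems.GenusKolyvaginAtTwoPowDvdShaCardAtTwoRTJointCountDisjoint
import Summits.BirchSwinnertonDyer.BirchSwinnertonDyer.Theorems.GenusKolyvaginAtTwoPowDvdShaCardAtTwoRTLadderFrameBookkeeping
import Summits.BirchSwinnertonDyer.BirchSwinnertonDyer.Theorems.GenusKolyvaginAtTwoCasselsTateNumberField
import Literature.NumberTheory.EllipticCurves.ShaRestriction
import Mathlib.GroupTheory.FiniteAbelian.Basic
import HarnessLib

/-!
# Route `GenusKolyvaginAtTwo`, LINE 18 v5 (L_T `PowDvdShaCardAtTwoRT`, stmt-BirchSwinnertonDyer-23242) — the J′ closer FED FROM THE ℚ-SIDE: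
# L's (+)-ladder VERBATIM through `res_K`, a transported (−)-ladder, disjoint spans ⟹ `2^{2M₀} ∣ #Ш(W_K)[2^∞]`

Seat `bsd-line-gk2-p4` g17 (WIDTH-5 attach, cell `bsd-f1-sign2`), `--supports stmt-BirchSwinnertonDyer-23242` (helper; closes nothing).
THEOREMS ONLY (no definition, no named fact, no `sorry`); BSD is not proved by any of this; neither is L_T.

This instantiates `…RTJointCountDisjoint` §3 (`pow_two_mul_dvd_natCard_of_ladders_map_of_disjoint_of_even`) in L_T's currency, discharging
every bookkeeping hypothesis that does not depend on the twin-side transport: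
* `finite_closure_of_isOfFinAddOrder` — the span of finitely many torsion classes of an abelian group is finite (containers for the ladders);
* **`pow_two_mul_dvd_natCard_sha_baseChange_of_res_ladders`** — `W/ℚ` elliptic, `K` a number field, `Ш(W_K/K)[2^∞]` finite; the (+)-ladder
  EXACTLY as stub L `stub_twinShaLaddersAtTwo` delivers it (families `x m : Fin (2m+2) → H¹(ℚ, W)`, `res_K (x m i) ∈ Ш(W_K)`, orders
  `2^{M(2m) − M(2m+1)}`, independent in `H¹(ℚ, W)`); the (−)-ladder as families in any group `G₂` with an INJECTIVE `g : G₂ → H¹(K, W_K)` landing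
  in `Ш(W_K)` (intended: `G₂ = H¹(ℚ, Wd)`, `g` = twist isomorphism `∘ res_K`, injective on the habitat by gk2-p2's `…RTGenusKernelTwin`);
  `#ker(H¹(ℚ,W) → H¹(K,W_K)) ∣ 2` (gk2-p2 `natCard_localRestrictionKer_eq_two`: the genus class); and the spans of the two pushed ladders
  DISJOINT in `H¹(K, W_K)` ⟹ **`2 ^ (2 * M 0) ∣ Nat.card (Ш(W_K/K)[2^∞])`** — the conclusion of L_T for `M 0 = M₀`.  Cassels–Tate over `K`
  (`CasselsTateNumberField.isSquare_natCard_primaryComponent_sha`) refunds the genus bit inside the proof.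
What stays OPEN on this road (memo `Lines/plus-descent-deep-onesided.md` §6): the map `g` at the `Ш`-level (gk2-p2) and the DISJOINTNESS (§6(f):
more probes than primes).

References: [McCallumLMS1991] §5 Prop. 5.2, Thm. 5.4; [Kolyvagin1991StructureSha]; [SilvermanAEC2009] X.4.14.
-/

set_option autoImplicit false
-- the Theorems namespace of this sub repeats the summit name by design (D-0017 nested layout)
set_option linter.dupNamespace false

noncomputable section

open scoped Classical

namespace Summit.BirchSwinnertonDyer.BirchSwinnertonDyer.Theorems.GenusExact.PlusDescent

open WeierstrassCurve Literature.NumberTheory.EllipticCurves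

/-! ## §1 Containers: spans of finitely many torsion classes are finite -/

/-- The subgroup generated by a finite set of elements of finite order in an abelian group is finite (finitely generated + torsion).
[folklore] -/
theorem finite_closure_of_isOfFinAddOrder {G : Type*} [AddCommGroup G] {s : Set G} (hs : s.Finite)
    (hord : ∀ x ∈ s, IsOfFinAddOrder x) : Finite (AddSubgroup.closure s) := by
  haveI : AddGroup.FG (AddSubgroup.closure s) := by
    rw [AddGroup.fg_iff_addSubgroup_fg]
    exact ⟨hs.toFinset, by rw [hs.coe_toFinset]⟩
  refine AddCommGroup.finite_of_fg_torsion _ fun g ↦ ?_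
  have hle : AddSubgroup.closure s ≤ AddCommGroup.torsion G :=
    (AddSubgroup.closure_le _).mpr fun x hx ↦ (AddCommGroup.mem_torsion x).mpr (hord x hx)
  have hg : IsOfFinAddOrder (g : G) := (AddCommGroup.mem_torsion _).mp (hle g.2)
  rw [← addOrderOf_pos_iff] at hg ⊢
  rwa [← addOrderOf_injective (AddSubgroup.closure s).subtype (AddSubgroup.closure s).subtype_injective g]

/-! ## §2 The J′ closer from L's (+)-ladder through `res_K` -/

/-- **L_T's conclusion from: L's (+)-ladder through `res_K`, a transported (−)-ladder, the genus kernel of order `≤ 2`, and DISJOINT spans.**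
`W/ℚ` elliptic, `K` a number field with `Ш(W_K/K)[2^∞]` finite; `g : G₂ → H¹(K, W_K)` injective; antitone `M`, `M (2T) = 0`; for `m < T`:
`x m` = `2m+2` classes of `H¹(ℚ, W)`, independent, of order `2^{M(2m) − M(2m+1)}`, restricting into `Ш(W_K)`; `x′ m` = `2m+2` elements of `G₂`,
independent, of order `2^{M(2m+1) − M(2m+2)}`, mapping into `Ш(W_K)`; `#ker(res_K) ∣ 2`; the images of the two spans disjoint.  Then
`2^{2·M 0} ∣ #Ш(W_K/K)[2^∞]`. [cite: McCallumLMS1991, §5 Thm. 5.4] [cite: SilvermanAEC2009, X.4.14] -/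
theorem pow_two_mul_dvd_natCard_sha_baseChange_of_res_ladders (W : WeierstrassCurve ℚ) [W.IsElliptic]
    (K : Type) [Field K] [NumberField K] [Finite (AddCommGroup.primaryComponent (W.baseChange K).sha 2)]
    {G₂ : Type} [AddCommGroup G₂] (g : G₂ →+ (W.baseChange K).galH1) (hg : Function.Injective g)
    (T : ℕ) (M : ℕ → ℕ) (hM : ∀ j, M (j + 1) ≤ M j) (hMT : M (2 * T) = 0)
    (x : (m : ℕ) → Fin (2 * m + 2) → W.galH1)
    (hres : ∀ m < T, ∀ i, resBaseChange W K (x m i) ∈ (W.baseChange K).sha)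
    (hord : ∀ m < T, ∀ i, addOrderOf (x m i) = 2 ^ (M (2 * m) - M (2 * m + 1)))
    (hind : ∀ m < T, ∀ c : Fin (2 * m + 2) → ℤ, ∑ i, c i • x m i = 0 →
      ∀ i, ((2 ^ (M (2 * m) - M (2 * m + 1)) : ℕ) : ℤ) ∣ c i)
    (x' : (m : ℕ) → Fin (2 * m + 2) → G₂)
    (hsha' : ∀ m < T, ∀ i, g (x' m i) ∈ (W.baseChange K).sha)
    (hord' : ∀ m < T, ∀ i, addOrderOf (x' m i) = 2 ^ (M (2 * m + 1) - M (2 * m + 2)))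
    (hind' : ∀ m < T, ∀ c : Fin (2 * m + 2) → ℤ, ∑ i, c i • x' m i = 0 →
      ∀ i, ((2 ^ (M (2 * m + 1) - M (2 * m + 2)) : ℕ) : ℤ) ∣ c i)
    (hker : Nat.card (W.localRestrictionKer K) ∣ 2)
    (hdis : Disjoint ((AddSubgroup.closure (⋃ m ∈ Finset.range T, Set.range (x m))).map (resBaseChange W K))
      ((AddSubgroup.closure (⋃ m ∈ Finset.range T, Set.range (x' m))).map g)) :
    2 ^ (2 * M 0) ∣ Nat.card (AddCommGroup.primaryComponent (W.baseChange K).sha 2) := by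
  haveI : Fact (Nat.Prime 2) := ⟨Nat.prime_two⟩
  set Sp : Set W.galH1 := ⋃ m ∈ Finset.range T, Set.range (x m) with hSp
  set Sm : Set G₂ := ⋃ m ∈ Finset.range T, Set.range (x' m) with hSm
  set U := AddSubgroup.closure Sp with hU
  set V := AddSubgroup.closure Sm with hV
  -- the generators: members of the families, of `2`-power order
  have hmemSp : ∀ s ∈ Sp, ∃ m, m < T ∧ ∃ i, x m i = s := fun s hs ↦ by
    simp only [hSp, Set.mem_iUnion, Set.mem_range, Finset.mem_range, exists_prop] at hs
    exact hs
  have hmemSm : ∀ s ∈ Sm, ∃ m, m < T ∧ ∃ i, x' m i = s := fun s hs ↦ by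
    simp only [hSm, Set.mem_iUnion, Set.mem_range, Finset.mem_range, exists_prop] at hs
    exact hs
  have hxU : ∀ m < T, ∀ i, x m i ∈ U := fun m hm i ↦ AddSubgroup.subset_closure (by
    simp only [hSp, Set.mem_iUnion, Set.mem_range, Finset.mem_range, exists_prop]
    exact ⟨m, hm, i, rfl⟩)
  have hxV : ∀ m < T, ∀ i, x' m i ∈ V := fun m hm i ↦ AddSubgroup.subset_closure (by
    simp only [hSm, Set.mem_iUnion, Set.mem_range, Finset.mem_range, exists_prop]
    exact ⟨m, hm, i, rfl⟩)
  -- containers are finite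
  haveI : Finite U := by
    refine finite_closure_of_isOfFinAddOrder ((Finset.range T).finite_toSet.biUnion fun m _ ↦ Set.finite_range _)
      fun s hs ↦ ?_
    obtain ⟨m, hm, i, rfl⟩ := hmemSp s hs
    rw [← addOrderOf_pos_iff, hord m hm i]
    positivity
  haveI : Finite V := by
    refine finite_closure_of_isOfFinAddOrder ((Finset.range T).finite_toSet.biUnion fun m _ ↦ Set.finite_range _)
      fun s hs ↦ ?_
    obtain ⟨m, hm, i, rfl⟩ := hmemSm s hs
    rw [← addOrderOf_pos_iff, hord' m hm i]
    positivity
  -- the target: `Ш(W_K)[2^∞]` as a subgroup of `H¹(K, W_K)`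
  set P := AddCommGroup.primaryComponent (W.baseChange K).sha 2 with hP
  set S : AddSubgroup (W.baseChange K).galH1 := P.map (W.baseChange K).sha.subtype with hS
  have hcardS : Nat.card S = Nat.card P := AddSubgroup.card_map_of_injective (W.baseChange K).sha.subtype_injective
  haveI : Finite S := Nat.finite_of_card_ne_zero (by rw [hcardS]; exact Nat.card_pos.ne')
  have hmemS : ∀ y : (W.baseChange K).galH1, y ∈ (W.baseChange K).sha → (∃ k : ℕ, 2 ^ k • y = 0) → y ∈ S :=
      fun y hy hk ↦ by
    obtain ⟨k, hk⟩ := hk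
    refine ⟨⟨y, hy⟩, ?_, rfl⟩
    exact (AddCommGroup.mem_primaryComponent).mpr ⟨k, Subtype.ext (by simpa using hk)⟩
  have hpow : ∀ {H : Type} [AddCommGroup H] (φ : H →+ (W.baseChange K).galH1) (z : H) (e : ℕ), addOrderOf z = 2 ^ e →
      ∃ k : ℕ, 2 ^ k • φ z = 0 := fun φ z e hz ↦
    ⟨e, by rw [← map_nsmul, ← hz, addOrderOf_nsmul_eq_zero, map_zero]⟩
  have hfU : U.map (resBaseChange W K) ≤ S := by
    rw [AddMonoidHom.map_closure]
    refine (AddSubgroup.closure_le _).mpr ?_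
    rintro _ ⟨s, hs, rfl⟩
    obtain ⟨m, hm, i, rfl⟩ := hmemSp s hs
    exact hmemS _ (hres m hm i) (hpow (resBaseChange W K) (x m i) _ (hord m hm i))
  have hgV : V.map g ≤ S := by
    rw [AddMonoidHom.map_closure]
    refine (AddSubgroup.closure_le _).mpr ?_
    rintro _ ⟨s, hs, rfl⟩
    obtain ⟨m, hm, i, rfl⟩ := hmemSm s hs
    exact hmemS _ (hsha' m hm i) (hpow g (x' m i) _ (hord' m hm i))
  -- kernels: the genus class on the `W` side, nothing on the twin side
  have hkerEq : (resBaseChange W K).ker = W.localRestrictionKer K := AddSubgroup.ext fun c ↦ by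
    rw [AddMonoidHom.mem_ker]
    exact mem_ker_resBaseChange_iff W K c
  have hker₁ : Nat.card ↥((resBaseChange W K).ker ⊓ U) ∣ 2 :=
    (AddSubgroup.card_dvd_of_le inf_le_left).trans (by rw [hkerEq]; exact hker)
  have hker₂ : g.ker ⊓ V = ⊥ := by rw [(AddMonoidHom.ker_eq_bot_iff g).mpr hg, bot_inf_eq]
  -- Cassels–Tate over `K`: `v₂ #Ш(W_K)[2^∞]` is even
  have heven : Even (padicValNat 2 (Nat.card S)) := by
    rw [hcardS]
    exact even_padicValNat_of_isSquare Nat.card_pos.ne'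
      (CasselsTateNumberField.isSquare_natCard_primaryComponent_sha (W.baseChange K) 2)
  have h := pow_two_mul_dvd_natCard_of_ladders_map_of_disjoint_of_even T M hM hMT (resBaseChange W K) g U V S hfU hgV hker₁
    hker₂ hdis heven
    (fun m hm ↦ ⟨x m, hxU m hm, hord m hm, hind m hm⟩) (fun m hm ↦ ⟨x' m, hxV m hm, hord' m hm, hind' m hm⟩)
  rwa [hcardS] at h

end Summit.BirchSwinnertonDyer.BirchSwinnertonDyer.Theorems.GenusExact.PlusDescent

end
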